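import Summits.HubbardSuperconductivity.HubbardSuperconductivity.Theorems.AnisotropyChordTransferFibre3N1Row
import Summits.HubbardSuperconductivity.HubbardSuperconductivity.Theorems.AnisotropyChordTransferFibre3TplusBracket
import Summits.HubbardSuperconductivity.HubbardSuperconductivity.Theorems.AnisotropyChordTransferFibre3N1FromPieces

/-!
# Route `AnisotropyChord` / H0 rotor rung: PartN41-B §7 targets PROVED — `TplusFromPC0`, `N1FromPieces` (for `0 ≤ Δ`)

The two assembly targets of the ported N₁-row statement file `…Fibre3N1Row` (theory-1 g22 PartN41B «FINAL» c7018b4c2cca2022,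
ported by p2 g4 p759662) are the content theorems `KT1Assembly.Tplus_bracket` (…TplusBracket) and `KT1Assembly.n1_ge_pieces`
(…N1FromPieces): `tplusFromPC0_holds : TplusFromPC0 L Δ` (every `Δ`) and `n1FromPieces_holds : 0 ≤ Δ → N1FromPieces L Δ`
(the `A(x̂)` term needs `Δ ≥ 0`; theory-1 REPORT 1 agreed).
Prover seat `hubbard-h0-rotor-p1` g26 (route lead; per-row assembly); helper for stmt-HubbardSuperconductivity-23918 (`--supports`, helper class).
WHAT THIS IS NOT: nothing here proves superconductivity in the Hubbard model; assembly bookkeeping of ONE row of ONE conditional reduction.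
Tree imports only; no new definitions; no sorry, no axioms.
-/

set_option linter.dupNamespace false
set_option autoImplicit false

noncomputable section

namespace Summit.HubbardSuperconductivity.HubbardSuperconductivity.Theorems.AnisotropyChord.Transfer.Fibre3

variable (L : ℕ) [NeZero L]

/-- ★ `TplusFromPC0 L Δ` holds. [folklore] -/
theorem tplusFromPC0_holds (Δ : ℝ) : TplusFromPC0 L Δ := by
  intro lam2 f hf Qlo Qhi Plo Phi hQ1 hQ2 hPlo hP1 hP2
  exact KT1Assembly.Tplus_bracket L hf hPlo hP1 hP2 hQ1 hQ2

/-- ★ `N1FromPieces L Δ` holds for `0 ≤ Δ` (`L ≥ 3`). [folklore] -/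
theorem n1FromPieces_holds (hL : 3 ≤ L) {Δ : ℝ} (hΔ0 : 0 ≤ Δ) : N1FromPieces L Δ := by
  intro lam2 f hf hl0 Blo Bhi Plo Phi Ahi Qlo Qhi Clo hB1 hB2 _hBhi hPlo hP1 hP2 hA hQ1 hQ2 hC
  exact KT1Assembly.n1_ge_pieces L hL hΔ0 hf hl0 hB1 hB2 hPlo hP1 hP2 hA hQ1 hQ2 hC

end Summit.HubbardSuperconductivity.HubbardSuperconductivity.Theorems.AnisotropyChord.Transfer.Fibre3

end
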